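import Mathlib
import Literature.Probability.LatticeModels.TorusFourierProofs

/-!
# Route BalabanIR — crux 4R `BirGappedPhaseReductionR` (item `stmt-HubbardSuperconductivity-14846`):
# block-London coercivity II — the block (London) misalignment functional is dominated by the
# `ℓ`-shifted difference functional (Jensen / Cauchy–Schwarz on blocks)

Partition the torus `(ℤ/L)²` (`ℓ ∣ L`) into `ℓ × ℓ` blocks `[kℓ,(k+1)ℓ) × [k'ℓ,(k'+1)ℓ)`, labelled by
their corners `bc x = (⌊x₀/ℓ⌋ℓ, ⌊x₁/ℓ⌋ℓ)`, and let `m_b(u) = ℓ⁻² Σ_{x ∈ b} u_x` be the block mean of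
a complex field `u` (for `u = e^{iθ}` this is the block circular mean of the card
`london-block-coercivity`, `Cruxes/BirGappedPhaseReductionR/Ideas/london-block-coercivity.md`,
whose `blockMisalignment ℓ θ = Σ_b (|m_b - m_{b+ℓe₀}|² + |m_b - m_{b+ℓe₁}|²)` is the left side
below).  THEOREM (`blockMis_le_shift`):
`Σ_b (|m_b - m_{b+ℓe₀}|² + |m_b - m_{b+ℓe₁}|²) ≤ ℓ⁻² Σ_x (|u_x - u_{x+ℓe₀}|² + |u_x - u_{x+ℓe₁}|²)`.
PROOF. `ℓ ∣ L` makes `x ↦ x + ℓeᵢ` a bijection of block `b` onto block `b + ℓeᵢ`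
(`blockCorner_add_shift₀/₁`), so `m_b - m_{b+ℓeᵢ} = ℓ⁻² Σ_{x∈b} (u_x - u_{x+ℓeᵢ})`; a block has at
most `ℓ²` sites (`card_block_le`), so Cauchy–Schwarz gives `|m_b - m_{b+ℓeᵢ}|² ≤ ℓ⁻² Σ_{x∈b}
|u_x - u_{x+ℓeᵢ}|²`, and the blocks partition the torus.  Together with the Fourier form of the
shifted-difference functional (file `…BlockLondonSymbol`) this bounds the block functional by a
translation-invariant one with symbol `ℓ⁻² Σᵢ |1 - χ_q(ℓeᵢ)|²`.  Elementary; no definition is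
introduced (the block maps are written inline, exactly as on the card).
-/

noncomputable section

namespace Summit.HubbardSuperconductivity.HubbardSuperconductivity.Theorems

namespace BirBdG

open Finset Literature.Probability.LatticeModels

/-! ### The block floor `a ↦ ⌊a/ℓ⌋ℓ` on `ℕ` and on `ℤ/L` -/

/-- `⌊(a+ℓ)/ℓ⌋ℓ = ⌊a/ℓ⌋ℓ + ℓ`. [folklore] -/
theorem blockFloor_add_self {ℓ : ℕ} (hℓ : 0 < ℓ) (a : ℕ) : (a + ℓ) / ℓ * ℓ = a / ℓ * ℓ + ℓ := by
  rw [Nat.add_div_right a hℓ, Nat.succ_mul]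

/-- `⌊a/ℓ⌋ℓ ≤ a < ⌊a/ℓ⌋ℓ + ℓ`. [folklore] -/
theorem blockFloor_le_lt {ℓ : ℕ} (hℓ : 0 < ℓ) (a : ℕ) : a / ℓ * ℓ ≤ a ∧ a < a / ℓ * ℓ + ℓ :=
  ⟨Nat.div_mul_le_self a ℓ, Nat.lt_div_mul_add hℓ⟩

/-- When `ℓ ∣ L`, the block floor commutes with reduction mod `L`:
`⌊(a mod L)/ℓ⌋ℓ ≡ ⌊a/ℓ⌋ℓ (mod L)`. [folklore] -/
theorem blockFloor_mod_cast {L ℓ : ℕ} (hℓ : 0 < ℓ) (hdiv : ℓ ∣ L) (a : ℕ) :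
    (((a % L) / ℓ * ℓ : ℕ) : ZMod L) = ((a / ℓ * ℓ : ℕ) : ZMod L) := by
  obtain ⟨c, hc⟩ := hdiv
  have key : a / ℓ * ℓ = (a % L) / ℓ * ℓ + L * (a / L) := by
    conv_lhs => rw [← Nat.mod_add_div a L]
    rw [hc, mul_assoc, Nat.add_mul_div_left _ _ hℓ, Nat.add_mul]
    congr 1
    ring
  rw [key]
  push_cast
  rw [ZMod.natCast_self, zero_mul, add_zero]

variable {L : ℕ} [NeZero L]

/-- The block-corner map commutes with the block shift `x ↦ x + ℓe₀` (`ℓ ∣ L`). [folklore] -/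
theorem blockCorner_add_shift₀ {ℓ : ℕ} (hℓ : 0 < ℓ) (hdiv : ℓ ∣ L) (x : TorusSite 2 L) :
    (![((((x + ![((ℓ : ℕ) : ZMod L), 0]) 0).val / ℓ * ℓ : ℕ) : ZMod L),
        ((((x + ![((ℓ : ℕ) : ZMod L), 0]) 1).val / ℓ * ℓ : ℕ) : ZMod L)] : TorusSite 2 L) =
      ![(((x 0).val / ℓ * ℓ : ℕ) : ZMod L), (((x 1).val / ℓ * ℓ : ℕ) : ZMod L)] +
        ![((ℓ : ℕ) : ZMod L), 0] := by
  have h0 : (x + ![((ℓ : ℕ) : ZMod L), 0]) 0 = x 0 + ((ℓ : ℕ) : ZMod L) := by simp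
  have h1 : (x + ![((ℓ : ℕ) : ZMod L), 0]) 1 = x 1 := by simp
  have hval : (x 0 + ((ℓ : ℕ) : ZMod L)).val = ((x 0).val + ℓ) % L := by
    rw [ZMod.val_add, ZMod.val_natCast, Nat.add_mod_mod]
  ext i
  fin_cases i
  · simp only [Fin.zero_eta, Fin.isValue, Matrix.cons_val_zero, Pi.add_apply, h0]
    rw [hval, blockFloor_mod_cast hℓ hdiv, blockFloor_add_self hℓ]
    push_cast
    rfl
  · simp only [Fin.mk_one, Fin.isValue, Matrix.cons_val_one, Matrix.cons_val_fin_one, Pi.add_apply, h1,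
      add_zero]

/-- The block-corner map commutes with the block shift `x ↦ x + ℓe₁` (`ℓ ∣ L`). [folklore] -/
theorem blockCorner_add_shift₁ {ℓ : ℕ} (hℓ : 0 < ℓ) (hdiv : ℓ ∣ L) (x : TorusSite 2 L) :
    (![((((x + ![0, ((ℓ : ℕ) : ZMod L)]) 0).val / ℓ * ℓ : ℕ) : ZMod L),
        ((((x + ![0, ((ℓ : ℕ) : ZMod L)]) 1).val / ℓ * ℓ : ℕ) : ZMod L)] : TorusSite 2 L) =
      ![(((x 0).val / ℓ * ℓ : ℕ) : ZMod L), (((x 1).val / ℓ * ℓ : ℕ) : ZMod L)] +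
        ![0, ((ℓ : ℕ) : ZMod L)] := by
  have h0 : (x + ![0, ((ℓ : ℕ) : ZMod L)]) 0 = x 0 := by simp
  have h1 : (x + ![0, ((ℓ : ℕ) : ZMod L)]) 1 = x 1 + ((ℓ : ℕ) : ZMod L) := by simp
  have hval : (x 1 + ((ℓ : ℕ) : ZMod L)).val = ((x 1).val + ℓ) % L := by
    rw [ZMod.val_add, ZMod.val_natCast, Nat.add_mod_mod]
  ext i
  fin_cases i
  · simp only [Fin.zero_eta, Fin.isValue, Matrix.cons_val_zero, Pi.add_apply, h0, add_zero]
  · simp only [Fin.mk_one, Fin.isValue, Matrix.cons_val_one, Matrix.cons_val_fin_one, Pi.add_apply, h1]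
    rw [hval, blockFloor_mod_cast hℓ hdiv, blockFloor_add_self hℓ]
    push_cast
    rfl

/-- A block has at most `ℓ²` sites: `#{x : bc x = b} ≤ ℓ²`. [folklore] -/
theorem card_block_le {ℓ : ℕ} (hℓ : 0 < ℓ) (b : TorusSite 2 L) :
    (Finset.univ.filter (fun x : TorusSite 2 L =>
        (![(((x 0).val / ℓ * ℓ : ℕ) : ZMod L), (((x 1).val / ℓ * ℓ : ℕ) : ZMod L)] : TorusSite 2 L) = b)).card
      ≤ ℓ ^ 2 := by
  classical
  set φ : Fin ℓ × Fin ℓ → TorusSite 2 L :=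
    fun r => ![b 0 + ((r.1 : ℕ) : ZMod L), b 1 + ((r.2 : ℕ) : ZMod L)] with hφ
  have hsub : Finset.univ.filter (fun x : TorusSite 2 L =>
      (![(((x 0).val / ℓ * ℓ : ℕ) : ZMod L), (((x 1).val / ℓ * ℓ : ℕ) : ZMod L)] : TorusSite 2 L) = b)
        ⊆ Finset.univ.image φ := by
    intro x hx
    rw [Finset.mem_filter] at hx
    have hb0 : (((x 0).val / ℓ * ℓ : ℕ) : ZMod L) = b 0 := by
      have := congrFun hx.2 0
      simpa using this
    have hb1 : (((x 1).val / ℓ * ℓ : ℕ) : ZMod L) = b 1 := by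
      have := congrFun hx.2 1
      simpa using this
    rw [Finset.mem_image]
    refine ⟨(⟨(x 0).val % ℓ, Nat.mod_lt _ hℓ⟩, ⟨(x 1).val % ℓ, Nat.mod_lt _ hℓ⟩), Finset.mem_univ _, ?_⟩
    have e0 : b 0 + (((x 0).val % ℓ : ℕ) : ZMod L) = x 0 := by
      rw [← hb0, ← Nat.cast_add, Nat.div_add_mod', ZMod.natCast_zmod_val]
    have e1 : b 1 + (((x 1).val % ℓ : ℕ) : ZMod L) = x 1 := by
      rw [← hb1, ← Nat.cast_add, Nat.div_add_mod', ZMod.natCast_zmod_val]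
    ext i
    fin_cases i
    · simpa [hφ] using e0
    · simpa [hφ] using e1
  calc (Finset.univ.filter (fun x : TorusSite 2 L =>
        (![(((x 0).val / ℓ * ℓ : ℕ) : ZMod L), (((x 1).val / ℓ * ℓ : ℕ) : ZMod L)] : TorusSite 2 L) = b)).card
      ≤ (Finset.univ.image φ).card := Finset.card_le_card hsub
    _ ≤ (Finset.univ : Finset (Fin ℓ × Fin ℓ)).card := Finset.card_image_le
    _ = ℓ ^ 2 := by simp [sq]

/-- Cauchy–Schwarz on a block: `|Σ_{x∈b} w_x|² ≤ ℓ² Σ_{x∈b} |w_x|²`. [folklore] -/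
theorem normSq_blockSum_le {ℓ : ℕ} (hℓ : 0 < ℓ) (b : TorusSite 2 L) (w : TorusSite 2 L → ℂ) :
    ‖∑ x : TorusSite 2 L, (if (![(((x 0).val / ℓ * ℓ : ℕ) : ZMod L), (((x 1).val / ℓ * ℓ : ℕ) : ZMod L)]
        : TorusSite 2 L) = b then w x else 0)‖ ^ 2 ≤
      (ℓ : ℝ) ^ 2 * ∑ x : TorusSite 2 L, (if (![(((x 0).val / ℓ * ℓ : ℕ) : ZMod L),
        (((x 1).val / ℓ * ℓ : ℕ) : ZMod L)] : TorusSite 2 L) = b then ‖w x‖ ^ 2 else 0) := by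
  classical
  set S := Finset.univ.filter (fun x : TorusSite 2 L =>
    (![(((x 0).val / ℓ * ℓ : ℕ) : ZMod L), (((x 1).val / ℓ * ℓ : ℕ) : ZMod L)] : TorusSite 2 L) = b) with hS
  rw [← Finset.sum_filter, ← Finset.sum_filter, ← hS]
  have hcard : (S.card : ℝ) ≤ (ℓ : ℝ) ^ 2 := by exact_mod_cast card_block_le hℓ b
  calc ‖∑ x ∈ S, w x‖ ^ 2 ≤ (∑ x ∈ S, ‖w x‖) ^ 2 := by
        gcongr
        exact norm_sum_le _ _
    _ ≤ S.card * ∑ x ∈ S, ‖w x‖ ^ 2 := sq_sum_le_card_mul_sum_sq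
    _ ≤ (ℓ : ℝ) ^ 2 * ∑ x ∈ S, ‖w x‖ ^ 2 := by
        gcongr

/-- **The block misalignment functional is dominated by the `ℓ`-shifted difference functional**
(Jensen on blocks; `ℓ ∣ L`).  With `bc x = (⌊x₀/ℓ⌋ℓ, ⌊x₁/ℓ⌋ℓ)` the block corner of `x` and
`bm b = ℓ⁻² Σ_{x : bc x = b} u_x` the block mean (card `london-block-coercivity`'s `blockMean`,
for `u = e^{iθ}`): `Σ_{b corner} (|bm b - bm (b+ℓe₀)|² + |bm b - bm (b+ℓe₁)|²) ≤
ℓ⁻² Σ_x (|u_x - u_{x+ℓe₀}|² + |u_x - u_{x+ℓe₁}|²)`. [folklore] -/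
theorem blockMis_le_shift : ∀ (L ℓ : ℕ) [NeZero L], 0 < ℓ → ℓ ∣ L → ∀ u : Literature.Probability.LatticeModels.TorusSite 2 L → ℂ, let bc : Literature.Probability.LatticeModels.TorusSite 2 L → Literature.Probability.LatticeModels.TorusSite 2 L := fun x => ![(((x 0).val / ℓ * ℓ : ℕ) : ZMod L), (((x 1).val / ℓ * ℓ : ℕ) : ZMod L)]; let bm : Literature.Probability.LatticeModels.TorusSite 2 L → ℂ := fun b => (∑ x : Literature.Probability.LatticeModels.TorusSite 2 L, if bc x = b then u x else 0) / ((ℓ : ℂ) ^ 2); ∑ b : Literature.Probability.LatticeModels.TorusSite 2 L, (if bc b = b then (‖bm b - bm (b + ![((ℓ : ℕ) : ZMod L), 0])‖ ^ 2 + ‖bm b - bm (b + ![0, ((ℓ : ℕ) : ZMod L)])‖ ^ 2) else 0) ≤ ((ℓ : ℝ) ^ 2)⁻¹ * ∑ x : Literature.Probability.LatticeModels.TorusSite 2 L, (‖u x - u (x + ![((ℓ : ℕ) : ZMod L), 0])‖ ^ 2 + ‖u x - u (x + ![0, ((ℓ : ℕ) : ZMod L)])‖ ^ 2) := by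
  intro L ℓ _ hℓ hdiv u bc bm
  classical
  have hℓR : (ℓ : ℝ) ≠ 0 := by exact_mod_cast hℓ.ne'
  have hℓC : ((ℓ : ℂ) ^ 2) ≠ 0 := pow_ne_zero 2 (by exact_mod_cast hℓ.ne')
  -- the two block shifts
  set e₀ : TorusSite 2 L := ![((ℓ : ℕ) : ZMod L), 0] with he₀
  set e₁ : TorusSite 2 L := ![0, ((ℓ : ℕ) : ZMod L)] with he₁
  have hbc₀ : ∀ x, bc (x + e₀) = bc x + e₀ := fun x => blockCorner_add_shift₀ hℓ hdiv x
  have hbc₁ : ∀ x, bc (x + e₁) = bc x + e₁ := fun x => blockCorner_add_shift₁ hℓ hdiv x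
  -- difference of block means along a block shift
  have hdiff : ∀ (e : TorusSite 2 L), (∀ x, bc (x + e) = bc x + e) → ∀ b,
      bm b - bm (b + e) = (∑ x, if bc x = b then (u x - u (x + e)) else 0) / ((ℓ : ℂ) ^ 2) := by
    intro e he b
    have hre : (∑ y, if bc y = b + e then u y else 0) = ∑ x, if bc x = b then u (x + e) else 0 := by
      rw [← Equiv.sum_comp (Equiv.addRight e)]
      refine Finset.sum_congr rfl fun x _ => ?_
      simp only [Equiv.coe_addRight, he x, add_left_inj]
    show (∑ x, if bc x = b then u x else 0) / ((ℓ : ℂ) ^ 2) -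
        (∑ y, if bc y = b + e then u y else 0) / ((ℓ : ℂ) ^ 2) = _
    rw [hre, ← sub_div, ← Finset.sum_sub_distrib]
    congr 1
    refine Finset.sum_congr rfl fun x _ => ?_
    split_ifs <;> simp
  -- Cauchy–Schwarz on each block, each direction
  have hblock : ∀ (e : TorusSite 2 L), (∀ x, bc (x + e) = bc x + e) → ∀ b,
      ‖bm b - bm (b + e)‖ ^ 2 ≤
        ((ℓ : ℝ) ^ 2)⁻¹ * ∑ x, if bc x = b then ‖u x - u (x + e)‖ ^ 2 else 0 := by
    intro e he b
    rw [hdiff e he b, norm_div, norm_pow, Complex.norm_natCast, div_pow]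
    have hcs := normSq_blockSum_le (L := L) hℓ b (fun x => u x - u (x + e))
    change ‖∑ x, if bc x = b then (u x - u (x + e)) else 0‖ ^ 2 ≤
      (ℓ : ℝ) ^ 2 * ∑ x, if bc x = b then ‖u x - u (x + e)‖ ^ 2 else 0 at hcs
    rw [div_le_iff₀ (by positivity)]
    calc ‖∑ x, if bc x = b then (u x - u (x + e)) else 0‖ ^ 2
        ≤ (ℓ : ℝ) ^ 2 * ∑ x, if bc x = b then ‖u x - u (x + e)‖ ^ 2 else 0 := hcs
      _ = ((ℓ : ℝ) ^ 2)⁻¹ * (∑ x, if bc x = b then ‖u x - u (x + e)‖ ^ 2 else 0) *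
            ((ℓ : ℝ) ^ 2) ^ 2 := by
          field_simp
  -- blocks partition the torus
  have hpart : ∀ g : TorusSite 2 L → ℝ,
      ∑ b, ∑ x, (if bc x = b then g x else 0) = ∑ x, g x := by
    intro g
    rw [Finset.sum_comm]
    refine Finset.sum_congr rfl fun x _ => ?_
    rw [Finset.sum_ite_eq]
    simp
  -- assemble
  calc ∑ b, (if bc b = b then (‖bm b - bm (b + e₀)‖ ^ 2 + ‖bm b - bm (b + e₁)‖ ^ 2) else 0)
      ≤ ∑ b, (‖bm b - bm (b + e₀)‖ ^ 2 + ‖bm b - bm (b + e₁)‖ ^ 2) := by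
        refine Finset.sum_le_sum fun b _ => ?_
        split_ifs
        · exact le_rfl
        · positivity
    _ ≤ ∑ b, (((ℓ : ℝ) ^ 2)⁻¹ * (∑ x, if bc x = b then ‖u x - u (x + e₀)‖ ^ 2 else 0) +
          ((ℓ : ℝ) ^ 2)⁻¹ * (∑ x, if bc x = b then ‖u x - u (x + e₁)‖ ^ 2 else 0)) := by
        refine Finset.sum_le_sum fun b _ => add_le_add (hblock e₀ hbc₀ b) (hblock e₁ hbc₁ b)
    _ = ((ℓ : ℝ) ^ 2)⁻¹ * ∑ x, (‖u x - u (x + e₀)‖ ^ 2 + ‖u x - u (x + e₁)‖ ^ 2) := by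
        rw [Finset.sum_add_distrib, ← Finset.mul_sum, ← Finset.mul_sum, hpart, hpart, ← mul_add,
          ← Finset.sum_add_distrib]

end BirBdG

end Summit.HubbardSuperconductivity.HubbardSuperconductivity.Theorems

end
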